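import Summits.Ventures.AbcShadow.SH02.TraceCount
import Literature.NumberTheory.EllipticCurves.HasseManin

/-!
# Venture AbcShadow — SH-02 kernel checker for `c ∉ S_ℓ`: annihilation witnesses against Mathlib's group law

HONEST FRAMING. Certificate-checker file of the work-bound cell `abc-shadow` (typer seat `abc-shadow-typ-2`); no
Diophantine statement, no claim on abc or on any summit, no side on IUT. It provides the KERNEL machinery that
discharges the second half of the COMPUTED kill-prime data of `SH02/KillData.lean` — "`a_ℓ(G_{w,v}) ≠ c` for every
admissible `w ∈ 𝔽_ℓ`" — by the ANNIHILATION-WITNESS method of the cell's third computation path (abc-iut-inv-6 g5,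
K4-THIRDPATH.md): for each `w` a point `P_w ∈ G_{w,v}(𝔽_ℓ)` with `(ℓ + 1 − c) · P_w ≠ O`, whence
`#G_{w,v}(𝔽_ℓ) ≠ ℓ + 1 − c` (Lagrange: `#G · P = O`, Mathlib's `card_nsmul_eq_zero'`), i.e. `a_ℓ(G_{w,v}) ≠ c`.

* `zinv b = b^{ℓ−2}` (`= b⁻¹`, Fermat), `slopeR` = Mathlib's `WeierstrassCurve.Affine.slope` with division replaced by
  `zinv` (`slopeR_eq`), `rawAdd` = Mathlib's affine addition `WeierstrassCurve.Affine.Point.add` on raw pairs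
  (`toRaw_add : toRaw (P + Q) = rawAdd (toRaw P) (toRaw Q)`), `rawSmul` = double-and-add (`rawSmul_eq :
  rawSmul n (toRaw P) = toRaw (n • P)`). Mathlib's own `Point` addition is computable but divides in `ZMod ℓ` through
  an extended-gcd inverse the kernel cannot evaluate at this scale; everything else is Mathlib's verbatim.
* `sqrtTS` — Tonelli–Shanks (no correctness claimed or needed: the checker re-verifies `y² = f(x)`).
* `checkW ℓ v N q s z fuel w` — for `G = bs23Frey 73 w v` over `ZMod ℓ`: inadmissible `w` (`w² = 73^{2v+1}`) pass;
  else search `x = 1, …, fuel` with `f(x)` a nonzero square, `y = sqrtTS(f(x))`, verify `y² = f(x)` and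
  `N · (x, y) ≠ O`; `checkW_sound`: a pass gives `#G(𝔽_ℓ) ≠ N`. `checkRange` loops `checkW` (`Nat.rec`).
* `delta_bs23Frey` (`Δ = 64·73^{2v+1}·(w² − 73^{2v+1})²`), `natCard_bs23Frey_neg` (`G_{−w} ≅ G_w`, halves the work),
  `apTrace_sq_le` (the tree's PROVED Hasse theorem), `killCert_of_kernel` (assembly of `KillCert ℓ v c`).
The per-prime kernel runs (`decide +kernel` on `checkRange … = true`, chunked) are in `SH02/Kill7841*.lean`,
`SH02/Kill41189*.lean`. References: H. Cohen, GTM 138, §1.5 (Tonelli–Shanks), §7.4; the cell's K4-THIRDPATH.md.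
-/

namespace Summit.Ventures.AbcShadow

/-! ## Field inverse by Fermat and the slope -/

/-- `b⁻¹` in `ZMod ℓ` as `b^{ℓ−2}` (kernel-evaluable; `zinv_eq`). [folklore] -/
def zinv {ℓ : ℕ} (b : ZMod ℓ) : ZMod ℓ :=
  powFast b (ℓ - 2)

/-- `zinv b = b⁻¹` for an odd prime `ℓ` (Fermat's little theorem, Mathlib `ZMod.pow_card_sub_one_eq_one`; and
`0^{ℓ−2} = 0 = 0⁻¹`). [folklore] -/
theorem zinv_eq {ℓ : ℕ} [Fact ℓ.Prime] (hℓ2 : ℓ ≠ 2) (b : ZMod ℓ) : zinv b = b⁻¹ := by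
  have hℓ3 : 3 ≤ ℓ := by
    have := (Fact.out : ℓ.Prime).two_le
    omega
  unfold zinv
  rw [powFast_eq]
  by_cases hb : b = 0
  · subst hb
    rw [inv_zero, zero_pow (by omega)]
  · have h1 : b ^ (ℓ - 1) = 1 := ZMod.pow_card_sub_one_eq_one hb
    have h2 : b ^ (ℓ - 2) * b = 1 := by
      rw [← pow_succ, show ℓ - 2 + 1 = ℓ - 1 by omega, h1]
    exact (inv_eq_of_mul_eq_one_left h2).symm

/-- Mathlib's `WeierstrassCurve.Affine.slope` with `/` replaced by `* zinv` (kernel-evaluable; `slopeR_eq`).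
[folklore] -/
def slopeR {ℓ : ℕ} (W : WeierstrassCurve (ZMod ℓ)) (x₁ x₂ y₁ y₂ : ZMod ℓ) : ZMod ℓ :=
  if x₁ = x₂ then
    (if y₁ = W.toAffine.negY x₂ y₂ then 0
      else (3 * x₁ ^ 2 + 2 * W.a₂ * x₁ + W.a₄ - W.a₁ * y₁) * zinv (y₁ - W.toAffine.negY x₁ y₁))
  else (y₁ - y₂) * zinv (x₁ - x₂)

/-- `slopeR = slope`. [folklore] -/
theorem slopeR_eq {ℓ : ℕ} [Fact ℓ.Prime] (hℓ2 : ℓ ≠ 2) (W : WeierstrassCurve (ZMod ℓ)) (x₁ x₂ y₁ y₂ : ZMod ℓ) :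
    slopeR W x₁ x₂ y₁ y₂ = W.toAffine.slope x₁ x₂ y₁ y₂ := by
  unfold slopeR WeierstrassCurve.Affine.slope
  simp only [zinv_eq hℓ2, div_eq_mul_inv]

/-! ## Affine addition and scalar multiplication on raw pairs -/

/-- Mathlib's affine addition law (`WeierstrassCurve.Affine.Point.add`: `O + P = P`, `P + O = P`, `(x₁,y₁) + (x₂,y₂) = O`
if `x₁ = x₂` and `y₁ = −y₂ − a₁x₂ − a₃`, else the chord/tangent point `(addX, addY)` at the slope) on raw pairs
`Option (𝔽_ℓ × 𝔽_ℓ)` (`none = O`), with the slope `slopeR`; `toRaw_add`. [folklore] -/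
def rawAdd {ℓ : ℕ} (W : WeierstrassCurve (ZMod ℓ)) :
    Option (ZMod ℓ × ZMod ℓ) → Option (ZMod ℓ × ZMod ℓ) → Option (ZMod ℓ × ZMod ℓ)
  | none, Q => Q
  | some P, none => some P
  | some (x₁, y₁), some (x₂, y₂) =>
    if x₁ = x₂ ∧ y₁ = W.toAffine.negY x₂ y₂ then none
    else some (W.toAffine.addX x₁ x₂ (slopeR W x₁ x₂ y₁ y₂), W.toAffine.addY x₁ x₂ y₁ (slopeR W x₁ x₂ y₁ y₂))

/-- Forget the nonsingularity proof of a Mathlib affine point: `O ↦ none`, `(x, y) ↦ some (x, y)`. [folklore] -/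
def toRaw {ℓ : ℕ} {W : WeierstrassCurve (ZMod ℓ)} : W.toAffine.Point → Option (ZMod ℓ × ZMod ℓ)
  | .zero => none
  | .some x y _ => some (x, y)

/-- `toRaw O = none`. [folklore] -/
theorem toRaw_zero {ℓ : ℕ} {W : WeierstrassCurve (ZMod ℓ)} : toRaw (0 : W.toAffine.Point) = none :=
  rfl

/-- **`rawAdd` is Mathlib's group law**: `toRaw (P + Q) = rawAdd W (toRaw P) (toRaw Q)`. [folklore] -/
theorem toRaw_add {ℓ : ℕ} [Fact ℓ.Prime] (hℓ2 : ℓ ≠ 2) {W : WeierstrassCurve (ZMod ℓ)} (P Q : W.toAffine.Point) :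
    toRaw (P + Q) = rawAdd W (toRaw P) (toRaw Q) := by
  rcases P with _ | ⟨x₁, y₁, h₁⟩ <;> rcases Q with _ | ⟨x₂, y₂, h₂⟩
  · rfl
  · rfl
  · rfl
  · by_cases hxy : x₁ = x₂ ∧ y₁ = W.toAffine.negY x₂ y₂
    · rw [WeierstrassCurve.Affine.Point.add_of_Y_eq hxy.1 hxy.2]
      simp only [toRaw, rawAdd, if_pos hxy]
    · rw [WeierstrassCurve.Affine.Point.add_some hxy]
      simp only [toRaw, rawAdd, if_neg hxy, slopeR_eq hℓ2]

/-- Double-and-add with fuel `k` (a plain `Nat.rec`): `n · P` for `n < 2^k`. [folklore] -/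
def rawSmulFuel {ℓ : ℕ} (W : WeierstrassCurve (ZMod ℓ)) (P : Option (ZMod ℓ × ZMod ℓ)) (k : ℕ) :
    ℕ → Option (ZMod ℓ × ZMod ℓ) :=
  Nat.rec (motive := fun _ => ℕ → Option (ZMod ℓ × ZMod ℓ)) (fun _ => none)
    (fun _ ih n => if n = 0 then none else
      let h := ih (n / 2)
      let d := rawAdd W h h
      if n % 2 = 0 then d else rawAdd W d P) k

/-- **Scalar multiplication on raw pairs** `rawSmul W n P` (`= toRaw (n • P)`, `rawSmul_eq`). [folklore] -/
def rawSmul {ℓ : ℕ} (W : WeierstrassCurve (ZMod ℓ)) (n : ℕ) (P : Option (ZMod ℓ × ZMod ℓ)) :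
    Option (ZMod ℓ × ZMod ℓ) :=
  rawSmulFuel W P (Nat.log2 n + 1) n

/-- `rawSmulFuel` computes `n • P` for `n < 2^k`. [folklore] -/
theorem rawSmulFuel_eq {ℓ : ℕ} [Fact ℓ.Prime] (hℓ2 : ℓ ≠ 2) {W : WeierstrassCurve (ZMod ℓ)}
    (P : W.toAffine.Point) : ∀ (k n : ℕ), n < 2 ^ k → rawSmulFuel W (toRaw P) k n = toRaw (n • P)
  | 0, n, hn => by
    have : n = 0 := by omega
    subst this
    rw [zero_nsmul]
    rfl
  | k + 1, n, hn => by
    show (if n = 0 then none else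
      let h := rawSmulFuel W (toRaw P) k (n / 2)
      let d := rawAdd W h h
      if n % 2 = 0 then d else rawAdd W d (toRaw P)) = toRaw (n • P)
    by_cases h0 : n = 0
    · rw [if_pos h0, h0, zero_nsmul]
      rfl
    · rw [if_neg h0]
      have hk : n / 2 < 2 ^ k := by
        have : 2 ^ (k + 1) = 2 * 2 ^ k := by ring
        omega
      simp only [rawSmulFuel_eq hℓ2 P k (n / 2) hk, ← toRaw_add hℓ2, ← add_nsmul, ← succ_nsmul]
      by_cases h2 : n % 2 = 0
      · rw [if_pos h2]
        congr 2
        omega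
      · rw [if_neg h2]
        congr 2
        omega

/-- `rawSmul W n (toRaw P) = toRaw (n • P)`. [folklore] -/
theorem rawSmul_eq {ℓ : ℕ} [Fact ℓ.Prime] (hℓ2 : ℓ ≠ 2) {W : WeierstrassCurve (ZMod ℓ)} (P : W.toAffine.Point)
    (n : ℕ) : rawSmul W n (toRaw P) = toRaw (n • P) :=
  rawSmulFuel_eq hℓ2 P _ n Nat.lt_log2_self

/-! ## Square roots (Tonelli–Shanks; unverified, re-checked by the checker) -/

/-- Number of squarings of `u` needed to reach `1`, capped by the fuel. [folklore] -/
def tsFindI {ℓ : ℕ} (u : ZMod ℓ) : ℕ → ℕ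
  | 0 => 0
  | m + 1 => if u = 1 then 0 else tsFindI (u * u) m + 1

/-- `b^{2^m}` by `m` squarings. [folklore] -/
def tsPow2 {ℓ : ℕ} (b : ZMod ℓ) : ℕ → ZMod ℓ
  | 0 => b
  | m + 1 => tsPow2 (b * b) m

/-- The Tonelli–Shanks loop (fuel, `t`, `R`, `c`, `M` ↦ candidate root). [folklore] -/
def tsStep {ℓ : ℕ} : ℕ → ZMod ℓ → ZMod ℓ → ZMod ℓ → ℕ → ZMod ℓ
  | 0, _, R, _, _ => R
  | fuel + 1, t, R, c, M =>
    if t = 1 then R else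
      let i := tsFindI t M
      let b := tsPow2 c (M - i - 1)
      tsStep fuel (t * (b * b)) (R * b) (b * b) i

/-- **Tonelli–Shanks**: a candidate square root of `a` in `ZMod ℓ`, where `ℓ − 1 = q · 2^s` (`q` odd) and `z` is a
quadratic non-residue. No correctness is claimed (the checker squares the result). [folklore] -/
def sqrtTS {ℓ : ℕ} (q s : ℕ) (z a : ZMod ℓ) : ZMod ℓ :=
  tsStep s (powFast a q) (powFast a ((q + 1) / 2)) (powFast z q) s

/-! ## The per-`w` checker -/

/-- One candidate abscissa `x`: `f(x)` must be a nonzero square (Euler), `y = sqrtTS(f(x))` must satisfy `y² = f(x)`,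
and `N · (x, y) ≠ O` on the raw group law. [folklore] -/
def checkX {ℓ : ℕ} (G : WeierstrassCurve (ZMod ℓ)) (N q s : ℕ) (z x : ZMod ℓ) : Bool :=
  let fx := rhs G x
  if eulerChi fx = 1 then
    (let y := sqrtTS q s z fx
     decide (y ^ 2 = fx) && (rawSmul G N (some (x, y))).isSome)
  else false

/-- Search `x = 1, …, k` (smallest first). [folklore] -/
def searchX {ℓ : ℕ} (G : WeierstrassCurve (ZMod ℓ)) (N q s : ℕ) (z : ZMod ℓ) : ℕ → Bool
  | 0 => false
  | k + 1 => searchX G N q s z k || checkX G N q s z ((k + 1 : ℕ) : ZMod ℓ)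

/-- **The per-`w` check** for the Frey–Hellegouarch curve `G_{w,v} = bs23Frey 73 w v` over `ZMod ℓ` against the
target order `N = ℓ + 1 − c`: inadmissible `w` (`w² − 73^{2v+1} = 0`) pass vacuously; otherwise an annihilation
witness must be found among `x ≤ fuel`. Parameters: `ℓ − 1 = q·2^s`, `z` a non-residue (for `sqrtTS`).
[folklore] -/
def checkW (ℓ v N q s : ℕ) (z : ZMod ℓ) (fuel w : ℕ) : Bool :=
  if (w : ZMod ℓ) ^ 2 - (73 : ZMod ℓ) ^ (2 * v + 1) = 0 then true
  else searchX (bs23Frey 73 (w : ZMod ℓ) v) N q s z fuel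

/-- **Range check** `lo ≤ w < lo + n`, as a plain `Nat.rec` loop. [folklore] -/
def checkRange (ℓ v N q s : ℕ) (z : ZMod ℓ) (fuel lo n : ℕ) : Bool :=
  Nat.rec (motive := fun _ => Bool) true (fun i acc => acc && checkW ℓ v N q s z fuel (lo + i)) n

/-! ## Soundness -/

/-- A passing `checkX` exhibits `y` with `y² = f(x)` and `N · (x, y) ≠ O` (raw). [folklore] -/
theorem checkX_sound {ℓ : ℕ} {G : WeierstrassCurve (ZMod ℓ)} {N q s : ℕ} {z x : ZMod ℓ}
    (h : checkX G N q s z x = true) :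
    ∃ y : ZMod ℓ, y ^ 2 = rhs G x ∧ (rawSmul G N (some (x, y))).isSome = true := by
  unfold checkX at h
  simp only at h
  split_ifs at h with h1
  · simp only [Bool.and_eq_true, decide_eq_true_eq] at h
    exact ⟨_, h.1, h.2⟩

/-- A passing `searchX` exhibits a raw point `(x, y)` on `y² = f(x)` with `N · (x, y) ≠ O`. [folklore] -/
theorem searchX_sound {ℓ : ℕ} {G : WeierstrassCurve (ZMod ℓ)} {N q s : ℕ} {z : ZMod ℓ} :
    ∀ k : ℕ, searchX G N q s z k = true →
      ∃ x y : ZMod ℓ, y ^ 2 = rhs G x ∧ (rawSmul G N (some (x, y))).isSome = true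
  | 0, h => by simp [searchX] at h
  | k + 1, h => by
    rw [searchX, Bool.or_eq_true] at h
    rcases h with h | h
    · exact searchX_sound k h
    · obtain ⟨y, hy, hs⟩ := checkX_sound h
      exact ⟨_, y, hy, hs⟩

/-- A passing range check passes every `w` in the range. [folklore] -/
theorem checkRange_sound {ℓ v N q s : ℕ} {z : ZMod ℓ} {fuel lo : ℕ} :
    ∀ n : ℕ, checkRange ℓ v N q s z fuel lo n = true → ∀ w : ℕ, lo ≤ w → w < lo + n →
      checkW ℓ v N q s z fuel w = true
  | 0, _, w, h1, h2 => by omega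
  | n + 1, h, w, h1, h2 => by
    have h' : (checkRange ℓ v N q s z fuel lo n && checkW ℓ v N q s z fuel (lo + n)) = true := h
    rw [Bool.and_eq_true] at h'
    by_cases hw : w = lo + n
    · rw [hw]
      exact h'.2
    · exact checkRange_sound n h'.1 w h1 (by omega)

/-- **Discriminant of the Frey–Hellegouarch curve**: `Δ(G_{w,v}) = 64·q^{2v+1}·(w² − q^{2v+1})²` (for
`Y² = X³ + aX² + bX`, `Δ = 16 b² (a² − 4b)` with `a = 2w`, `b = w² − q^{2v+1}`). [folklore] -/
theorem delta_bs23Frey {R : Type} [CommRing R] (q : ℕ) (w : R) (v : ℕ) :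
    (bs23Frey q w v).Δ = 64 * (q : R) ^ (2 * v + 1) * (w ^ 2 - (q : R) ^ (2 * v + 1)) ^ 2 := by
  simp only [bs23Frey, WeierstrassCurve.Δ, WeierstrassCurve.b₂, WeierstrassCurve.b₄, WeierstrassCurve.b₆,
    WeierstrassCurve.b₈]
  ring

/-- For a prime `ℓ ∤ 2·73` and an admissible `w` (`w² − 73^{2v+1} ≠ 0`), `Δ(G_{w,v}) ≠ 0` in `ZMod ℓ`. [folklore] -/
theorem delta_bs23Frey_ne_zero {ℓ : ℕ} [Fact ℓ.Prime] (hℓ2 : ℓ ≠ 2) (hℓ73 : ℓ ≠ 73) (w : ZMod ℓ) (v : ℕ)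
    (hw : w ^ 2 - (73 : ZMod ℓ) ^ (2 * v + 1) ≠ 0) : (bs23Frey 73 w v).Δ ≠ 0 := by
  have hp : ℓ.Prime := Fact.out
  have h64 : (64 : ZMod ℓ) ≠ 0 := by
    intro h
    have h' : ((64 : ℕ) : ZMod ℓ) = 0 := by exact_mod_cast h
    rw [ZMod.natCast_eq_zero_iff] at h'
    have : ℓ ∣ 2 := by
      have h64 : (64 : ℕ) = 2 ^ 6 := by norm_num
      rw [h64] at h'
      exact hp.dvd_of_dvd_pow h'
    have := Nat.le_of_dvd (by norm_num) this
    have := hp.two_le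
    omega
  have h73 : (73 : ZMod ℓ) ≠ 0 := by
    intro h
    have h' : ((73 : ℕ) : ZMod ℓ) = 0 := by exact_mod_cast h
    rw [ZMod.natCast_eq_zero_iff] at h'
    have := (Nat.prime_dvd_prime_iff_eq hp (by norm_num)).mp h'
    exact hℓ73 this
  rw [delta_bs23Frey]
  push_cast
  exact mul_ne_zero (mul_ne_zero h64 (pow_ne_zero _ h73)) (pow_ne_zero _ hw)

/-- **Soundness of the per-`w` check**: for a prime `ℓ ∤ 2·73` and an admissible `w < ℓ`... (any `w`; the residue
`w mod ℓ` is what is checked), a pass gives `#G_{w,v}(𝔽_ℓ) ≠ N` — the witness `(x, y)` is a nonsingular point `P`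
(`Δ ≠ 0`), `rawSmul` computes `toRaw (N • P) ≠ none`, whereas `#G · P = O` (`card_nsmul_eq_zero'`). [folklore] -/
theorem checkW_sound {ℓ : ℕ} [Fact ℓ.Prime] (hℓ2 : ℓ ≠ 2) (hℓ73 : ℓ ≠ 73) {v N q s : ℕ} {z : ZMod ℓ} {fuel w : ℕ}
    (h : checkW ℓ v N q s z fuel w = true) (hw : (w : ZMod ℓ) ^ 2 - (73 : ZMod ℓ) ^ (2 * v + 1) ≠ 0) :
    Nat.card (bs23Frey 73 (w : ZMod ℓ) v).toAffine.Point ≠ N := by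
  unfold checkW at h
  rw [if_neg hw] at h
  obtain ⟨x, y, hy, hs⟩ := searchX_sound fuel h
  set G := bs23Frey 73 (w : ZMod ℓ) v with hG
  have hΔ : G.Δ ≠ 0 := delta_bs23Frey_ne_zero hℓ2 hℓ73 (w : ZMod ℓ) v hw
  have hns : G.toAffine.Nonsingular x y :=
    (WeierstrassCurve.Affine.equation_iff_nonsingular_of_Δ_ne_zero hΔ).mp ((equation_iff_rhs G rfl rfl x y).mpr hy)
  let P : G.toAffine.Point := .some x y hns
  have hP : rawSmul G N (some (x, y)) = toRaw (N • P) := rawSmul_eq hℓ2 P N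
  intro hcard
  have h0 : N • P = 0 := by
    rw [← hcard]
    exact card_nsmul_eq_zero'
  rw [hP, h0, toRaw_zero] at hs
  exact Bool.false_ne_true hs

/-- From a passing per-`w` check to the trace: `a_ℓ(G_{w,v}) ≠ ℓ + 1 − N`. [folklore] -/
theorem apTrace_ne_of_checkW {ℓ : ℕ} [Fact ℓ.Prime] (hℓ2 : ℓ ≠ 2) (hℓ73 : ℓ ≠ 73) {v N q s : ℕ} {z : ZMod ℓ}
    {fuel w : ℕ} (h : checkW ℓ v N q s z fuel w = true)
    (hw : (w : ZMod ℓ) ^ 2 - (73 : ZMod ℓ) ^ (2 * v + 1) ≠ 0) :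
    apTrace ℓ (bs23Frey 73 (w : ZMod ℓ) v) ≠ (ℓ : ℤ) + 1 - N := by
  have := checkW_sound hℓ2 hℓ73 h hw
  unfold apTrace
  omega

/-! ## The symmetry `w ↦ −w`, the Hasse bound, and the assembly of a kill prime -/

/-- **`#G_{−w,v}(F) = #G_{w,v}(F)` over a field containing `i = √−1`**: `G_{−w,v} = flipNeg G_{w,v}`
(`(x, y) ↦ (−x, iy)`, `natCard_flipNeg`). Halves the kernel work: only `w ≤ ℓ/2` need checking. [folklore] -/
theorem natCard_bs23Frey_neg {F : Type} [Field F] [DecidableEq F] (q : ℕ) (i : F) (hi : i ^ 2 = -1) (w : F)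
    (v : ℕ) : Nat.card (bs23Frey q (-w) v).toAffine.Point = Nat.card (bs23Frey q w v).toAffine.Point := by
  have h : bs23Frey q (-w) v = flipNeg (bs23Frey q w v) := by
    ext <;> simp [bs23Frey, flipNeg]
  rw [h, natCard_flipNeg _ rfl rfl i hi]

/-- **Hasse bound for the trace** (the tree's PROVED Hasse theorem,
`Literature.NumberTheory.EllipticCurves.HasseManin.abs_card_sub_le`): for a Weierstrass curve `W` over `ZMod ℓ`
(`ℓ` prime) with `Δ ≠ 0`, `a_ℓ(W)² ≤ 4ℓ`. [cite: SilvermanAEC2009, Thm. V.1.1] -/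
theorem apTrace_sq_le {ℓ : ℕ} [Fact ℓ.Prime] (W : WeierstrassCurve (ZMod ℓ)) (hΔ : W.Δ ≠ 0) :
    (apTrace ℓ W) ^ 2 ≤ 4 * ℓ := by
  haveI : NeZero ℓ := ⟨(Fact.out : ℓ.Prime).ne_zero⟩
  haveI : W.IsElliptic := ⟨isUnit_iff_ne_zero.mpr hΔ⟩
  have h := Literature.NumberTheory.EllipticCurves.HasseManin.abs_card_sub_le W
  rw [ZMod.card] at h
  have h2 : ((Nat.card W.toAffine.Point : ℝ) - (ℓ + 1)) ^ 2 ≤ 4 * ℓ := by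
    have h' := pow_le_pow_left₀ (abs_nonneg _) h 2
    rw [sq_abs, mul_pow, Real.sq_sqrt (Nat.cast_nonneg ℓ)] at h'
    linarith
  have h3 : ((apTrace ℓ W : ℤ) : ℝ) ^ 2 ≤ 4 * ℓ := by
    have e : ((apTrace ℓ W : ℤ) : ℝ) = -((Nat.card W.toAffine.Point : ℝ) - (ℓ + 1)) := by
      unfold apTrace
      push_cast
      ring
    rw [e, neg_sq]
    exact h2
  exact_mod_cast h3

/-- **Assembly of a kill prime from kernel checks.** For a prime `ℓ ∤ 2·73` with `73` a non-square and `i² = −1` in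
`ZMod ℓ`, the two kernel-checked traces `a_ℓ(2336a1) = a_ℓ(2336b1) = c`, `N = ℓ + 1 − c`, a passing `checkW` for
every `w ≤ ℓ/2` (the other half by `w ↦ −w`), and `4ℓ ≤ B²`, `B + |c| < 1000` (Hasse: `|a| ≤ B`) give `KillCert ℓ v c`.
[folklore] -/
theorem killCert_of_kernel {ℓ v N q s fuel : ℕ} {z i : ZMod ℓ} {c : ℤ} (B : ℕ) [Fact ℓ.Prime]
    (hℓ2 : ℓ ≠ 2) (hℓ73 : ℓ ≠ 73) (hnsq : ¬ IsSquare (73 : ZMod ℓ)) (hi : i ^ 2 = -1)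
    (ha : apTrace ℓ (reduceMod ℓ e2336a1) = c) (hb : apTrace ℓ (reduceMod ℓ e2336b1) = c)
    (hN : (N : ℤ) = ℓ + 1 - c) (hall : ∀ w : ℕ, w ≤ ℓ / 2 → checkW ℓ v N q s z fuel w = true)
    (hB : 4 * (ℓ : ℤ) ≤ (B : ℤ) ^ 2) (hBc : (B : ℤ) + |c| < 1000) : KillCert ℓ v c := by
  have hp : ℓ.Prime := Fact.out
  haveI : NeZero ℓ := ⟨hp.ne_zero⟩
  refine ⟨hp, hℓ2, hℓ73, hnsq, ha, hb, fun a ha' => ?_⟩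
  obtain ⟨w, hw, rfl⟩ := ha'
  have hΔ := delta_bs23Frey_ne_zero hℓ2 hℓ73 w v hw
  have key : Nat.card (bs23Frey 73 w v).toAffine.Point ≠ N := by
    by_cases hle : w.val ≤ ℓ / 2
    · have hw1 : ((w.val : ℕ) : ZMod ℓ) ^ 2 - (73 : ZMod ℓ) ^ (2 * v + 1) ≠ 0 := by
        rwa [ZMod.natCast_zmod_val]
      have h := checkW_sound hℓ2 hℓ73 (hall w.val hle) hw1
      rwa [ZMod.natCast_zmod_val] at h
    · have hlt : w.val < ℓ := ZMod.val_lt w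
      have hle' : ℓ - w.val ≤ ℓ / 2 := by omega
      have hneg : ((ℓ - w.val : ℕ) : ZMod ℓ) = -w := by
        rw [Nat.cast_sub hlt.le, ZMod.natCast_self, zero_sub, ZMod.natCast_zmod_val]
      have hw' : ((ℓ - w.val : ℕ) : ZMod ℓ) ^ 2 - (73 : ZMod ℓ) ^ (2 * v + 1) ≠ 0 := by
        rwa [hneg, neg_sq]
      have h := checkW_sound hℓ2 hℓ73 (hall _ hle') hw'
      rwa [hneg, natCard_bs23Frey_neg 73 i hi w v] at h
  refine ⟨fun hac => key ?_, ?_⟩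
  · unfold apTrace at hac
    omega
  · have hsq := apTrace_sq_le (bs23Frey 73 w v) hΔ
    have habs : |apTrace ℓ (bs23Frey 73 w v)| ≤ B :=
      abs_le_of_sq_le_sq (by linarith) (by positivity)
    calc |apTrace ℓ (bs23Frey 73 w v) - c| ≤ |apTrace ℓ (bs23Frey 73 w v)| + |c| := abs_sub _ _
      _ < 1000 := by linarith

end Summit.Ventures.AbcShadow
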